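import Summits.RiemannHypothesis.RiemannHypothesis.Theorems.TiltedLandingLaw421R3SinkLemmaH

/-!
# W-08 · ⟨33346⟩ `TiltedLandingLaw421R`, regime 3′ — «SinkCompose»: 102 ∘ 104 BY NAME (token 107)

C1 «words / typing / kernel» desk (rh-idea-5 g39), IMAGE v1 — files-only (0 kit · 0 registry verbs · 0 proposals); proposed target
`Summits/RiemannHypothesis/RiemannHypothesis/Theorems/TiltedLandingLaw421R3SinkCompose.lean`, `--supports stmt-RiemannHypothesis-33346 --as helper`,
level SUPPORT (K only).  ONE import: the tree module of 104 «SinkLemmaH» (which imports 102 «SinkTemplate», ns `RhW08.SinkTemplate`, and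
`Literature.Analysis.Complex.HarmonicMaxPrinciple`).  Namespace `RhW08.SinkCompose`; nothing re-declared (director-rh (CA942): the sketch a62bd69d of
RESULT-3 as an image).

WHAT IS PROVED (bookkeeping, two terms): ★ `sinkAssembly_of_bdry` = C3's assembly `RhW08.SinkTemplate.sinkAssembly : AssemblySig` (102) with its
kernel-domination hypothesis (K) `KernelDom xv R cs w σ` WEAKENED to BOUNDARY domination (K∂) `KernelDomBdry xv R cs w σ` plus the child's near-window
position `|Re w − xv| < R/2`, conclusion unchanged `Lcert cs G σ ≤ L` — the interior domination is supplied by the tree theorem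
`RhW08.SinkLemmaH.sinkLemmaH : LemmaHSig` (104), whose pole conditions are read off `CutsAdmissible` (every cut point has `Re p_k = xv`, so
`|Re p_k − xv| = 0 < R/2`, `0 < R` being forced by `|Re w − xv| < R/2`); and `datum_of_bdry` = the same data plus 102's datum alternative (D)
`DatumAlt lam s gnorm cs G σ` and `0 < lam` ⇒ `gnorm ≤ lam·L ∨ 1/(2s) < L` (first disjunct: the sink inequality at `L = η/s`; second: non-realisability
under the cap `L ≤ 1/(2s)`).

LEFT OPEN for the cone, by 102's names (this file prices none of it): discharging (E) `−Im G = Σ' mᵢ·farPairC w (aᵢ)`, the seam reads and the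
summabilities from the tree at a real child (C4 «SinkFeed»), and the EXISTENCE of an admissible cut family with boundary domination for the right `σ`
together with (D) — `CertificatesExistSig lam` (102) / C3's `U3CertificatesExistSig`, conjectural.

LEVEL: SUPPORT (K).  Asserts no law.  No `sorry`, no new axiom, no `example` / `instance` / `notation` / `private` / `set_option`.  Nothing here bears on
the truth of RH; RH is not proved; ⟨33346⟩/⟨33347⟩ OPEN; socket 3′ `RhW08.NearCoincidentTie.HeavyMassWindowQ (1/2) 1` OPEN; checked ≠ keyed ≠ landed ≠ proved.
-/

noncomputable section

open Complex
open scoped ComplexConjugate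
open RhW08.SinkTemplate

namespace RhW08.SinkCompose

/-- ★ (K) ASSEMBLY FROM BOUNDARY DOMINATION: 102's `AssemblySig` with `KernelDom xv R cs w σ` replaced by `KernelDomBdry xv R cs w σ` plus the
near-window position of the child `|Re w − xv| < R/2`; conclusion unchanged `Lcert cs G σ ≤ L`.  Proof: `sinkAssembly … (sinkLemmaH … hB) …`, the cut
points' pole condition `|Re p_k − xv| = 0 < R/2` read off `CutsAdmissible`. -/
theorem sinkAssembly_of_bdry (κ : Type) [Fintype κ] (ι : Type) (a : ι → ℂ) (m : ι → ℝ) (xv R : ℝ) (cs : κ → Cut) (w G : ℂ)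
    (L σ : ℝ) (hm : ∀ i, 0 ≤ m i) (hstrip : ∀ i, MaxStrip xv R (a i)) (hadm : CutsAdmissible xv cs)
    (hw : |w.re - xv| < R / 2) (hB : KernelDomBdry xv R cs w σ)
    (hsum : ∀ k, Summable fun i => m i * (conj (cs k).e * (farPairK (a i) w - farPairK (a i) (cs k).p)).re)
    (hsumc : Summable fun i => m i * farPairC w (a i))
    (hE : -G.im = ∑' i, m i * farPairC w (a i))
    (hseam : ∀ k, (conj (cs k).e * G).re
        - ∑' i, m i * (conj (cs k).e * (farPairK (a i) w - farPairK (a i) (cs k).p)).re ≤ L) :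
    Lcert cs G σ ≤ L := by
  have hp : ∀ k, |(cs k).p.re - xv| < R / 2 := fun k => by
    rw [(hadm.1 k).2.2, sub_self, abs_zero]
    linarith [abs_nonneg (w.re - xv)]
  exact sinkAssembly κ ι a m xv R cs w G L σ hm hstrip hadm
    (RhW08.SinkLemmaH.sinkLemmaH κ xv R cs w σ hw hp hB) hsum hsumc hE hseam

/-- (K) the same, packaged as 102's `DatumAlt`-consumer shape: boundary domination + the assembly data ⇒ the FIRST disjunct of the datum alternative
turns into the sink inequality `gnorm ≤ lam · L` (for `0 < lam`), the SECOND into `1/(2s) < L` (non-realisability under the cap `L ≤ 1/(2s)`). -/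
theorem datum_of_bdry (κ : Type) [Fintype κ] (ι : Type) (a : ι → ℂ) (m : ι → ℝ) (xv R : ℝ) (cs : κ → Cut) (w G : ℂ)
    (L σ lam s gnorm : ℝ) (hlam : 0 < lam) (hm : ∀ i, 0 ≤ m i) (hstrip : ∀ i, MaxStrip xv R (a i)) (hadm : CutsAdmissible xv cs)
    (hw : |w.re - xv| < R / 2) (hB : KernelDomBdry xv R cs w σ)
    (hsum : ∀ k, Summable fun i => m i * (conj (cs k).e * (farPairK (a i) w - farPairK (a i) (cs k).p)).re)
    (hsumc : Summable fun i => m i * farPairC w (a i))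
    (hE : -G.im = ∑' i, m i * farPairC w (a i))
    (hseam : ∀ k, (conj (cs k).e * G).re
        - ∑' i, m i * (conj (cs k).e * (farPairK (a i) w - farPairK (a i) (cs k).p)).re ≤ L)
    (hD : DatumAlt lam s gnorm cs G σ) :
    gnorm ≤ lam * L ∨ 1 / (2 * s) < L := by
  have hLc : Lcert cs G σ ≤ L := sinkAssembly_of_bdry κ ι a m xv R cs w G L σ hm hstrip hadm hw hB hsum hsumc hE hseam
  rcases hD with h | h
  · left
    have : gnorm / lam ≤ L := h.trans hLc
    rwa [div_le_iff₀ hlam, mul_comm] at this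
  · right
    exact h.trans_le hLc

end RhW08.SinkCompose
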